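import Mathlib
import Summits.NavierStokesRegularity.NavierStokesRegularity.Theorems.EulerZoomLiouvillePowerGaugeEulerLiouvilleDriftClockAvoid
import Summits.NavierStokesRegularity.NavierStokesRegularity.Theorems.EulerZoomLiouvillePowerGaugeEulerLiouvilleDriftClockInvariantMember
import HarnessLib

/-!
# «ANY INWARD DRIFT KILLS», XII (T-I members): a power-law band deficit OFF AN A.E.-AVOIDED SET on a backward-invariant vortical region kills — centred and past-exact
# (crux `EulerZoomLiouville.PowerGaugeEulerLiouville` = stmt-NavierStokesRegularity-19832, THE ONE STATEMENT `stub_selfSimilarC2Needle`; via `HasResidenceClock` alt 6 «one clocked ball»)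

Route `EulerZoomLiouville` (NavierStokesRegularity), crux E; width seat ns-ezl-w1 g6 on the LEAD's free-hand target T-I («deficit off a set the backward orbits of
one ball a.s. avoid»).  By-name assembly of `DriftClock.powerClockAt_of_invariantBandDeficit_avoiding` (`…DriftClockAvoid`) with the bookkeeping of
`…DriftClockInvariantMember` and the LEAD's local thresholds `NeedleRace.selfSimilar_ae_eq_zero_of_localPowerClockC2` / `…_past`.
Notation: `W y = γy + V y`, `γ = 1/(2+ρ)`, `ℛ(y) = ⟪y, W y⟫`, `a(y) = ‖W y‖² + γℛ(y) + ⟪y, DV(y)(W y)⟫`.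

* `DriftClock.powerClockAt_of_invariantPowerBandDeficit_avoiding` — rpow form of the T-I engine (`0 ≤ p < ρ`, `0 ≤ q < 2+ρ+p`).
* **`Loc.selfSimilar_ae_eq_zero_of_avoidingBandDeficitC2_profile`** / **`Past.…_past`** — members: crux hypotheses (`0 < ρ ≤ ½`), exact self-similarity
  (about the origin / about `(T, x₀)` for `τ < T₁`), `V ∈ C²`, and for every classical pressure `P′`: an open backward-invariant `O` with a vortical point, a set
  `E` AVOIDED by the backward similarity arcs of a.e. label of `O`, and the power-law band deficit at the vortical points of `O ∖ E` beyond a radius ⇒ `u = 0` a.e.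
  ⊇ alternative 10 (`E = ∅`).

THE NEEDLE'S FACE after this (negation): for some classical `P′`, in every open backward-invariant region with a vortical point, for all admissible
`κb, a₀, e₁, e₂`, the circular centripetally balanced vortical cells are VISITED by the backward arcs of a NON-NULL set of labels — the first integrated
(measure) form of the channel face.
WHAT THIS IS NOT: not NS, not E — strata on the model lattice; DENT 0 on the registered stubs; 19832 OPEN; NS regularity is NOT proved; no summit statement is
proved by this seat. [folklore; ConstantinIgnatovaVicol2026Putative §3.4–§3.5]
-/
noncomputable section

-- flat `Theorems/<Route><Decl>…` files of one crux share the namespace of the crux (tree convention: `Summit.<S>.<S>.…`)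
set_option linter.dupNamespace false

open Set Filter Topology Metric Function MeasureTheory
open scoped RealInnerProductSpace NNReal ENNReal

namespace Summit.NavierStokesRegularity.NavierStokesRegularity.Theorems.PowerGaugeEulerLiouville

open Literature.Analysis Literature.Analysis.FluidPDE

namespace DriftClock

/-- **POWER-LAW CLOCK AT A BALL OFF AN AVOIDED SET**: an open backward-invariant region `O`, a set `E` avoided by the backward arcs of a.e. label of `O`, and the
pointwise power-law band deficit (`κb‖y‖^{−p}`, `a₀‖y‖^{−q}`, `0 ≤ p < ρ`, `0 ≤ q < 2+ρ+p`) at the vortical points of `O ∖ E` beyond radius `Rf` clock every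
vortical `x₀ ∈ O` — `DriftClock.powerClockAt_of_invariantBandDeficit_avoiding` ∘ `scaleBand_of_rpowBand` ∘ `rpowBudget`. [folklore; cf. ConstantinIgnatovaVicol2026Putative §3.4–§3.5] -/
theorem powerClockAt_of_invariantPowerBandDeficit_avoiding {ρ : ℝ} (hρ : 0 < ρ) (hρh : ρ ≤ 1 / 2)
    {V : EuclideanSpace ℝ (Fin 3) → EuclideanSpace ℝ (Fin 3)} {P' : EuclideanSpace ℝ (Fin 3) → ℝ}
    (hprof : IsSelfSimilarEulerProfile (1 / (2 + ρ)) 0 V P') {O : Set (EuclideanSpace ℝ (Fin 3))} (hO : IsOpen O)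
    (hinv : ∀ (Z : ℝ → EuclideanSpace ℝ (Fin 3)) (t : ℝ), 0 ≤ t →
      (∀ s ∈ Icc 0 t, HasDerivAt Z (-(selfSimilarTransport (1 / (2 + ρ)) 0 V (Z s))) s) → Z 0 ∈ O → Z t ∈ O)
    {E : Set (EuclideanSpace ℝ (Fin 3))}
    (havoid : ∀ᵐ y ∂(volume : Measure (EuclideanSpace ℝ (Fin 3))), y ∈ O →
      ∀ (Z : ℝ → EuclideanSpace ℝ (Fin 3)) (t : ℝ), 0 ≤ t →
        (∀ s ∈ Icc 0 t, HasDerivAt Z (-(selfSimilarTransport (1 / (2 + ρ)) 0 V (Z s))) s) → Z 0 = y → ∀ s ∈ Icc 0 t, Z s ∉ E)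
    {κb a₀ p q Rf : ℝ} (hκb : 0 < κb) (ha₀ : 0 < a₀) (hp0 : 0 ≤ p) (hpρ : p < ρ) (hq0 : 0 ≤ q) (hqρ : q < 2 + ρ + p)
    (hdef : ∀ y ∈ O, y ∉ E → Rf ≤ ‖y‖ → curl V y ≠ 0 →
      -(κb * ‖y‖ ^ (-p)) ≤ ⟪y, selfSimilarTransport (1 / (2 + ρ)) 0 V y⟫ → ⟪y, selfSimilarTransport (1 / (2 + ρ)) 0 V y⟫ ≤ 0 →
        a₀ * ‖y‖ ^ (-q) ≤ ‖selfSimilarTransport (1 / (2 + ρ)) 0 V y‖ ^ 2 +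
          (1 / (2 + ρ)) * ⟪y, selfSimilarTransport (1 / (2 + ρ)) 0 V y⟫ +
          ⟪y, fderiv ℝ V y (selfSimilarTransport (1 / (2 + ρ)) 0 V y)⟫)
    {x₀ : EuclideanSpace ℝ (Fin 3)} (hx₀O : x₀ ∈ O) (hx₀ : curl V x₀ ≠ 0) :
    ∀ c' : ℝ, 0 < c' → ∃ r : ℝ, 0 < r ∧ ∃ R₀ : ℝ,
      ∀ R : ℝ, R₀ ≤ R → ∀ (V' : EuclideanSpace ℝ (Fin 3) → EuclideanSpace ℝ (Fin 3)) (K Rbig : ℝ), ContDiff ℝ 2 V' →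
        (∀ y, ‖fderiv ℝ V' y‖ ≤ K) → 2 * R < Rbig →
        (∀ w ∈ ball (0 : EuclideanSpace ℝ (Fin 3)) Rbig, V' w = V w) →
        (volume (ball x₀ r ∩ {y | ∀ σ ∈ Icc 0 (c' * R ^ (2 + ρ)),
          ‖ODE.evolutionMap (fun _ : ℝ => selfSimilarTransport (1 / (2 + ρ)) 0 V') 0 (-σ) y‖ ≤ 2 * R})).toReal ≤
          (volume (ball x₀ r)).toReal / 2 :=
  powerClockAt_of_invariantBandDeficit_avoiding hρ hρh hprof hO hinv havoid (κ := fun R => κb * (2 * R) ^ (-p))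
    (a := fun R => a₀ * (2 * R) ^ (-q)) (fun R _ => by positivity) (fun R _ => by positivity)
    (fun R y hyO hyE => scaleBand_of_rpowBand (S := O \ E) hκb.le ha₀.le hp0 hq0 (fun y hy => hdef y hy.1 hy.2) R y ⟨hyO, hyE⟩)
    (rpowBudget hκb ha₀ hpρ hqρ) hx₀O hx₀

end DriftClock

/-- **EXACTLY SELF-SIMILAR MEMBERS WITH A BACKWARD-INVARIANT VORTICAL REGION CARRYING A POWER-LAW BAND DEFICIT OFF AN A.E.-AVOIDED SET ARE TRIVIAL** (see the module
docstring; crux hypotheses verbatim, `0 < ρ ≤ ½`, exact self-similarity about the origin, `V ∈ C²`).  Proof = classical pressure ⇒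
`DriftClock.powerClockAt_of_invariantPowerBandDeficit_avoiding` ⇒ `NeedleRace.selfSimilar_ae_eq_zero_of_localPowerClockC2`. [folklore; ConstantinIgnatovaVicol2026Putative §3.4–§3.5] -/
theorem Loc.selfSimilar_ae_eq_zero_of_avoidingBandDeficitC2_profile {ρ : ℝ} (hρ : 0 < ρ) (hρ1 : ρ ≤ 1 / 2)
    {u : ℝ → EuclideanSpace ℝ (Fin 3) → EuclideanSpace ℝ (Fin 3)} {p : ℝ → EuclideanSpace ℝ (Fin 3) → ℝ}
    {H : ℝ → EuclideanSpace ℝ (Fin 3) → EuclideanSpace ℝ (Fin 3) →L[ℝ] EuclideanSpace ℝ (Fin 3)} {c : ℝ≥0}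
    (hsw : IsSuitableWeakSolutionOn (slab (EuclideanSpace ℝ (Fin 3)) (Iio 0) isOpen_Iio) 0 0 u p)
    (hH : HasWeakSpatialGradientOn (slab (EuclideanSpace ℝ (Fin 3)) (Iio 0) isOpen_Iio) u H)
    (hgauge : ∀ a : ℝ, 0 < a →
      ENNReal.ofReal (a ^ (2 * ρ)) * cknA a (0 : ℝ × EuclideanSpace ℝ (Fin 3)) u +
          ENNReal.ofReal (a ^ ρ) * cknE a (0 : ℝ × EuclideanSpace ℝ (Fin 3)) H +
        ENNReal.ofReal (a ^ (2 * ρ)) * cknD a (0 : ℝ × EuclideanSpace ℝ (Fin 3)) p ≤ (c : ℝ≥0∞))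
    {V : EuclideanSpace ℝ (Fin 3) → EuclideanSpace ℝ (Fin 3)} {P : EuclideanSpace ℝ (Fin 3) → ℝ}
    (hu : ∀ τ : ℝ, τ < 0 → u τ = selfSimilarCollapse (1 / (2 + ρ)) 0 V τ)
    (hp : ∀ τ : ℝ, τ < 0 → p τ = selfSimilarCollapsePressure (1 / (2 + ρ)) 0 P τ)
    (hV : ContDiff ℝ 2 V)
    (hB : ∀ P' : EuclideanSpace ℝ (Fin 3) → ℝ, IsSelfSimilarEulerProfile (1 / (2 + ρ)) 0 V P' →
      ∃ O : Set (EuclideanSpace ℝ (Fin 3)), IsOpen O ∧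
        (∀ (Z : ℝ → EuclideanSpace ℝ (Fin 3)) (t : ℝ), 0 ≤ t →
          (∀ s ∈ Icc 0 t, HasDerivAt Z (-(selfSimilarTransport (1 / (2 + ρ)) 0 V (Z s))) s) → Z 0 ∈ O → Z t ∈ O) ∧
        (∃ x₀ ∈ O, curl V x₀ ≠ 0) ∧
        ∃ E : Set (EuclideanSpace ℝ (Fin 3)),
          (∀ᵐ y ∂(volume : Measure (EuclideanSpace ℝ (Fin 3))), y ∈ O →
            ∀ (Z : ℝ → EuclideanSpace ℝ (Fin 3)) (t : ℝ), 0 ≤ t →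
              (∀ s ∈ Icc 0 t, HasDerivAt Z (-(selfSimilarTransport (1 / (2 + ρ)) 0 V (Z s))) s) → Z 0 = y → ∀ s ∈ Icc 0 t, Z s ∉ E) ∧
        ∃ κb a₀ e₁ e₂ Rf : ℝ, 0 < κb ∧ 0 < a₀ ∧ 0 ≤ e₁ ∧ e₁ < ρ ∧ 0 ≤ e₂ ∧ e₂ < 2 + ρ + e₁ ∧
          ∀ y ∈ O, y ∉ E → Rf ≤ ‖y‖ → curl V y ≠ 0 →
            -(κb * ‖y‖ ^ (-e₁)) ≤ ⟪y, selfSimilarTransport (1 / (2 + ρ)) 0 V y⟫ →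
            ⟪y, selfSimilarTransport (1 / (2 + ρ)) 0 V y⟫ ≤ 0 →
            a₀ * ‖y‖ ^ (-e₂) ≤ ‖selfSimilarTransport (1 / (2 + ρ)) 0 V y‖ ^ 2 +
              (1 / (2 + ρ)) * ⟪y, selfSimilarTransport (1 / (2 + ρ)) 0 V y⟫ +
              ⟪y, fderiv ℝ V y (selfSimilarTransport (1 / (2 + ρ)) 0 V y)⟫) :
    uncurry u =ᵐ[volume.restrict (Iio (0 : ℝ) ×ˢ (univ : Set (EuclideanSpace ℝ (Fin 3))))] 0 := by
  have hρ1' : ρ < 1 := by linarith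
  -- ### a classical pressure for the profile
  have hD : ∀ a : ℝ, 0 < a → ENNReal.ofReal (a ^ (2 * ρ)) *
      cknD a (0 : ℝ × EuclideanSpace ℝ (Fin 3)) p ≤ (c : ℝ≥0∞) :=
    fun a ha => le_trans le_add_self (hgauge a ha)
  have hpm : AEStronglyMeasurable (uncurry p)
      (volume.restrict (Iio (0 : ℝ) ×ˢ (univ : Set (EuclideanSpace ℝ (Fin 3))))) := by
    have := hsw.distributional.2.2.1.aestronglyMeasurable
    simpa [slab] using this
  have hPm := aestronglyMeasurable_pressureProfile hpm hp
  have hDprof := profile_pressure_weight_of_gaugeD hρ hρ1' hpm hp hD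
  have hP1 : LocallyIntegrable P volume :=
    EnergySaturation.locallyIntegrable_pressure_of_weight hρ1' hPm
      (ENNReal.mul_ne_top ENNReal.ofReal_ne_top ENNReal.coe_ne_top) hDprof
  obtain ⟨P', hprof⟩ :=
    WeakToClassical.exists_isSelfSimilarEulerProfile_of_contDiff hsw.distributional hu hp hV hP1
  -- ### the region, its vortical point, and the clock at that point
  obtain ⟨O, hO, hinv, ⟨x₀, hx₀O, hx₀⟩, E, havoid, κb, a₀, e₁, e₂, Rf, hκb, ha₀, he₁, he₁ρ, he₂, he₂ρ, hdef⟩ := hB P' hprof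
  have hclock := DriftClock.powerClockAt_of_invariantPowerBandDeficit_avoiding hρ hρ1 hprof hO hinv havoid hκb ha₀ he₁ he₁ρ he₂ he₂ρ hdef hx₀O hx₀
  -- ### «one clocked ball kills»
  exact NeedleRace.selfSimilar_ae_eq_zero_of_localPowerClockC2 hρ hρ1 hsw hH hgauge hu hp hV
    (fun c' hc' => ⟨x₀, hclock c' hc'⟩)

namespace Past

variable {ρ T T₁ : ℝ}
  {u : ℝ → EuclideanSpace ℝ (Fin 3) → EuclideanSpace ℝ (Fin 3)} {p : ℝ → EuclideanSpace ℝ (Fin 3) → ℝ}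
  {H : ℝ → EuclideanSpace ℝ (Fin 3) → EuclideanSpace ℝ (Fin 3) →L[ℝ] EuclideanSpace ℝ (Fin 3)} {c : ℝ≥0}
  {V : EuclideanSpace ℝ (Fin 3) → EuclideanSpace ℝ (Fin 3)} {P : EuclideanSpace ℝ (Fin 3) → ℝ}

/-- **PAST-EXACT MEMBER WITH A BACKWARD-INVARIANT VORTICAL REGION CARRYING A POWER-LAW BAND DEFICIT OFF AN A.E.-AVOIDED SET IS TRIVIAL** (crux hypotheses verbatim,
`0 < ρ ≤ ½`; exact self-similarity about `(T, x₀)` for `τ < T₁`, `T₁ ≤ 0`, `T₁ ≤ T`; `V ∈ C²`).  Proof = `Past.exists_isSelfSimilarEulerProfile` ⇒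
`DriftClock.powerClockAt_of_invariantPowerBandDeficit_avoiding` ⇒ `NeedleRace.selfSimilar_ae_eq_zero_of_localPowerClockC2_past`. [folklore; ConstantinIgnatovaVicol2026Putative §3.4–§3.5] -/
theorem selfSimilar_ae_eq_zero_of_avoidingBandDeficitC2_profile_past (hρ : 0 < ρ) (hρh : ρ ≤ 1 / 2) (hT₁ : T₁ ≤ 0)
    (hTT₁ : T₁ ≤ T) (x₀ : EuclideanSpace ℝ (Fin 3))
    (hsw : IsSuitableWeakSolutionOn (slab (EuclideanSpace ℝ (Fin 3)) (Iio 0) isOpen_Iio) 0 0 u p)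
    (hH : HasWeakSpatialGradientOn (slab (EuclideanSpace ℝ (Fin 3)) (Iio 0) isOpen_Iio) u H)
    (hgauge : ∀ a : ℝ, 0 < a →
      ENNReal.ofReal (a ^ (2 * ρ)) * cknA a (0 : ℝ × EuclideanSpace ℝ (Fin 3)) u +
          ENNReal.ofReal (a ^ ρ) * cknE a (0 : ℝ × EuclideanSpace ℝ (Fin 3)) H +
        ENNReal.ofReal (a ^ (2 * ρ)) * cknD a (0 : ℝ × EuclideanSpace ℝ (Fin 3)) p ≤ (c : ℝ≥0∞))
    (hu : ∀ τ : ℝ, τ < T₁ → u τ = fun x => selfSimilarCollapse (1 / (2 + ρ)) T V τ (x - x₀))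
    (hp : ∀ τ : ℝ, τ < T₁ → p τ = fun x => selfSimilarCollapsePressure (1 / (2 + ρ)) T P τ (x - x₀))
    (hV : ContDiff ℝ 2 V)
    (hB : ∀ P' : EuclideanSpace ℝ (Fin 3) → ℝ, IsSelfSimilarEulerProfile (1 / (2 + ρ)) 0 V P' →
      ∃ O : Set (EuclideanSpace ℝ (Fin 3)), IsOpen O ∧
        (∀ (Z : ℝ → EuclideanSpace ℝ (Fin 3)) (t : ℝ), 0 ≤ t →
          (∀ s ∈ Icc 0 t, HasDerivAt Z (-(selfSimilarTransport (1 / (2 + ρ)) 0 V (Z s))) s) → Z 0 ∈ O → Z t ∈ O) ∧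
        (∃ x₁ ∈ O, curl V x₁ ≠ 0) ∧
        ∃ E : Set (EuclideanSpace ℝ (Fin 3)),
          (∀ᵐ y ∂(volume : Measure (EuclideanSpace ℝ (Fin 3))), y ∈ O →
            ∀ (Z : ℝ → EuclideanSpace ℝ (Fin 3)) (t : ℝ), 0 ≤ t →
              (∀ s ∈ Icc 0 t, HasDerivAt Z (-(selfSimilarTransport (1 / (2 + ρ)) 0 V (Z s))) s) → Z 0 = y → ∀ s ∈ Icc 0 t, Z s ∉ E) ∧
        ∃ κb a₀ e₁ e₂ Rf : ℝ, 0 < κb ∧ 0 < a₀ ∧ 0 ≤ e₁ ∧ e₁ < ρ ∧ 0 ≤ e₂ ∧ e₂ < 2 + ρ + e₁ ∧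
          ∀ y ∈ O, y ∉ E → Rf ≤ ‖y‖ → curl V y ≠ 0 →
            -(κb * ‖y‖ ^ (-e₁)) ≤ ⟪y, selfSimilarTransport (1 / (2 + ρ)) 0 V y⟫ →
            ⟪y, selfSimilarTransport (1 / (2 + ρ)) 0 V y⟫ ≤ 0 →
            a₀ * ‖y‖ ^ (-e₂) ≤ ‖selfSimilarTransport (1 / (2 + ρ)) 0 V y‖ ^ 2 +
              (1 / (2 + ρ)) * ⟪y, selfSimilarTransport (1 / (2 + ρ)) 0 V y⟫ +
              ⟪y, fderiv ℝ V y (selfSimilarTransport (1 / (2 + ρ)) 0 V y)⟫) :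
    uncurry u =ᵐ[volume.restrict (Iio (0 : ℝ) ×ˢ (univ : Set (EuclideanSpace ℝ (Fin 3))))] 0 := by
  -- ### a classical pressure for the profile (far-past extension)
  obtain ⟨P', hprof⟩ := exists_isSelfSimilarEulerProfile hρ hT₁ hTT₁ hsw.distributional hu hp hV
  -- ### the region, its vortical point, and the clock at that point
  obtain ⟨O, hO, hinv, ⟨x₁, hx₁O, hx₁⟩, E, havoid, κb, a₀, e₁, e₂, Rf, hκb, ha₀, he₁, he₁ρ, he₂, he₂ρ, hdef⟩ := hB P' hprof
  have hclock := DriftClock.powerClockAt_of_invariantPowerBandDeficit_avoiding hρ hρh hprof hO hinv havoid hκb ha₀ he₁ he₁ρ he₂ he₂ρ hdef hx₁O hx₁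
  -- ### «one clocked ball kills» (past twin)
  exact NeedleRace.selfSimilar_ae_eq_zero_of_localPowerClockC2_past hρ hρh hT₁ hTT₁ x₀ hsw hH hgauge hu hp hV
    (fun c' hc' => ⟨x₁, hclock c' hc'⟩)

end Past

end Summit.NavierStokesRegularity.NavierStokesRegularity.Theorems.PowerGaugeEulerLiouville

end
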